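import Summits.RiemannHypothesis.RiemannHypothesis.Theorems.Splittings.SplitXWucStarRowC
import Summits.RiemannHypothesis.RiemannHypothesis.Theorems.Splittings.SplitXWucK1RF
import HarnessLib

/-!
# x-wuc GEN-11 row ★₁₀₂₄ʳ — `HSW → K1′ → (RH ⟺ RH(e^1024) ∧ B′₁([−1,1]))` — tree port, part D (4/4)

Part D (section Repair): `massAwareSamplingL_of_kCertLR` (K-CERT′_{Lc}(δ,θ) ⟹ MassAwareSamplingL L δ θ for L ≥ Lc, via the ridge package — with the one `rfl` bridge `BombieriTruncMassAware.Phi = XWucG8.Phi`) and the ROW ★₁₀₂₄ʳ `rh_iff_rhUpTo_exp1024_and_boundedAwayAt_of_kCertLR : 0.042 ≤ θ → KCertLR 400 (3/2) θ → HSW → (RH ⟺ RH(e^1024) ∧ B′₁([−1,1]))` (over the K1R port's `CertBodyR`/`KCertLR`).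
Provenance, deltas and HONEST LABEL as in part A (`SplitXWucStarRowA.lean`): declarations verbatim from G11b 3a3eefe13ea0264d,
re-targeted onto the tree twins; CONDITIONAL bookkeeping; RH is not proved by this; nothing here bears on the truth of RH.
-/

-- D-0017: `Summit.RiemannHypothesis.RiemannHypothesis.…` duplicates the namespace BY DESIGN (single-problem summit).
set_option linter.dupNamespace false
noncomputable section

namespace Summit.RiemannHypothesis.RiemannHypothesis.Theorems.Splittings.XWucG8

open scoped Classical ComplexConjugate InnerProductSpace
open Set Filter Topology Complex MeasureTheory
open Literature.NumberTheory.LFunctions Literature.NumberTheory.LFunctions.Bombieri2000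
open Summit.RiemannHypothesis.RiemannHypothesis.Theses.RuelleBand
open Summit.RiemannHypothesis.RiemannHypothesis.Theorems.Splittings.BombieriTruncEigen
open Summit.RiemannHypothesis.RiemannHypothesis.Theorems.Splittings.BombieriFozNoDep
open Summit.RiemannHypothesis.RiemannHypothesis.Theorems.Splittings.BombieriTruncGram
open Summit.RiemannHypothesis.RiemannHypothesis.Theorems.Splittings.BombieriTruncPairing
open Summit.RiemannHypothesis.RiemannHypothesis.Theorems.Splittings.BombieriTruncScreening
open Summit.RiemannHypothesis.RiemannHypothesis.Theorems.Splittings.BombieriTruncBandGap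
open Summit.RiemannHypothesis.RiemannHypothesis.Theorems.Splittings.BombieriTruncMultiplicity
open Summit.RiemannHypothesis.RiemannHypothesis.Theorems.Splittings.BombieriTruncEventualStrip
open Summit.RiemannHypothesis.RiemannHypothesis.Theorems.Splittings.BombieriTruncExactness
open Summit.RiemannHypothesis.RiemannHypothesis.Theorems.Splittings.BombieriTruncClump
open Summit.RiemannHypothesis.RiemannHypothesis.Theorems.Splittings.BombieriTruncOffLineSparse
open Summit.RiemannHypothesis.RiemannHypothesis.Theorems.Splittings.BombieriTruncSynthesis
open Summit.RiemannHypothesis.RiemannHypothesis.Theorems.Splittings.BombieriTruncSynthesisScreening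
open Summit.RiemannHypothesis.RiemannHypothesis.Theorems.Splittings.BombieriTruncSynthesisRows
open Literature.NumberTheory.DiophantineGeometry (RiemannHypothesisUpTo)
open Summit.RiemannHypothesis.RiemannHypothesis.Theorems.Splittings.BombieriTruncMassAware
open Summit.RiemannHypothesis.RiemannHypothesis.Theorems.Splittings.MassAwareSamplingCeiling
variable {N : ℕ}

section Repair
open KCertRidge KCertBridge

/-- **REDUCTION for the repaired node: `KCertLR Lc δ θ → MassAwareSamplingL L δ θ`** for every cap `L ≥ Lc` and `θ > 0`.
Proof = G10b's (`massAwareSamplingL_of_kCertL`) with two edits: the band offered to the adversary is `Λ := e^{2πD}/4` (the maximum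
`MassAwareSamplingL` allows), and the dual value is used in full, `‖F‖² + D·credit ≤ q = ⟨G, F⟩` (`‖F‖² = ‖f‖²_{L²[−1,1]}`). -/
theorem massAwareSamplingL_of_kCertLR {Lc L δ θ : ℝ} (hL : Lc ≤ L) (hθ : 0 < θ) (h : KCertLR Lc δ θ) :
    MassAwareSamplingL L δ θ := by
  intro ε hε κ₀ hκ₀ hκ₀' D hD
  refine ⟨Real.exp (2 * Real.pi * D) / 4, by positivity, le_rfl, ?_⟩
  intro n lam w κ w₀ hw₀ hw₀' hw hκ hband
  -- the measure and the concrete functions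
  set μI : Measure ℝ := volume.restrict (Icc (-1 : ℝ) 1) with hμI
  have hgc : Continuous (fun u : ℝ ↦ 2 * (Real.sinh (κ₀ * u) : ℂ)) := by fun_prop
  have hφc : ∀ k : Fin n, Continuous (fun u : ℝ ↦ (Real.cosh (κ k * u) : ℂ) * cexp (-(I * (lam k : ℂ) * u))) := by
    intro k; fun_prop
  -- Hilbert-space elements of L²([-1,1])
  obtain ⟨G, hGdef⟩ : ∃ G : Lp ℂ 2 μI, G = (memLp_two_Icc_of_continuous hgc).toLp _ := ⟨_, rfl⟩
  obtain ⟨Φ, hΦdef⟩ : ∃ Φ : Fin n → Lp ℂ 2 μI, Φ = fun k ↦ (memLp_two_Icc_of_continuous (hφc k)).toLp _ :=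
    ⟨_, rfl⟩
  obtain ⟨b, hJ, hGF⟩ := ridge_package G Φ w hw
  refine ⟨b, ?_⟩
  obtain ⟨F, hFdef⟩ : ∃ F : Lp ℂ 2 μI, F = G - ∑ j, b j • Φ j := ⟨_, rfl⟩
  rw [← hFdef] at hJ hGF
  -- the residual as a genuine continuous function
  obtain ⟨f, hfdef⟩ : ∃ f : ℝ → ℂ, f = fun u ↦ 2 * (Real.sinh (κ₀ * u) : ℂ) -
      ∑ k, b k * (Real.cosh (κ k * u) : ℂ) * cexp (-(I * (lam k : ℂ) * u)) := ⟨_, rfl⟩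
  have hfc : Continuous f := by rw [hfdef]; fun_prop
  -- a.e. identities for the coercions to functions
  have hGae : (G : ℝ → ℂ) =ᵐ[μI] fun u ↦ 2 * (Real.sinh (κ₀ * u) : ℂ) := by
    rw [hGdef]; exact MemLp.coeFn_toLp _
  have hΦae : ∀ k, (Φ k : ℝ → ℂ) =ᵐ[μI] fun u ↦ (Real.cosh (κ k * u) : ℂ) * cexp (-(I * (lam k : ℂ) * u)) := by
    intro k; rw [hΦdef]; exact MemLp.coeFn_toLp _
  have hFae : (F : ℝ → ℂ) =ᵐ[μI] f := by
    have h1 := Lp.coeFn_sub G (∑ j, b j • Φ j)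
    have h2 := coeFn_finset_sum Finset.univ (fun j ↦ b j • Φ j)
    have h3 : ∀ j, ⇑(b j • Φ j) =ᵐ[μI] b j • ⇑(Φ j) := fun j ↦ Lp.coeFn_smul _ _
    filter_upwards [h1, h2, ae_all_iff.2 h3, ae_all_iff.2 hΦae, hGae] with u hu1 hu2 hu3 hu4 hu5
    rw [hFdef, hu1, Pi.sub_apply, hu5, hu2, hfdef]
    simp only
    congr 1
    refine Finset.sum_congr rfl fun j _ ↦ ?_
    rw [hu3 j, Pi.smul_apply, smul_eq_mul, hu4 j]
    simp only [mul_assoc]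
  -- inner products as integrals
  have hΦF : ∀ k, ⟪Φ k, F⟫_ℂ = tfT f (lam k) (κ k) := by
    intro k
    rw [inner_eq_integral]
    have hae : (fun x ↦ conj ((Φ k : ℝ → ℂ) x) * (F : ℝ → ℂ) x)
        =ᵐ[μI] fun x ↦ f x * (Real.cosh (κ k * x) : ℂ) * cexp (I * (lam k : ℂ) * x) := by
      filter_upwards [hΦae k, hFae] with x hx1 hx2
      rw [hx1, hx2, conj_kernel]; ring
    rw [integral_congr_ae hae]; rfl
  have hGF' : ⟪G, F⟫_ℂ = ∫ u in Icc (-1 : ℝ) 1, 2 * (Real.sinh (κ₀ * u) : ℂ) * f u := by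
    rw [inner_eq_integral]
    have hae : (fun x ↦ conj ((G : ℝ → ℂ) x) * (F : ℝ → ℂ) x)
        =ᵐ[μI] fun x ↦ 2 * (Real.sinh (κ₀ * x) : ℂ) * f x := by
      filter_upwards [hGae, hFae] with x hx1 hx2
      rw [hx1, hx2, map_mul, Complex.conj_ofReal, map_ofNat]
    rw [integral_congr_ae hae]
  -- NEW (G11): the ridge term is the L² norm of the residual
  have hFnorm : ‖F‖ ^ 2 = ∫ u in Icc (-1 : ℝ) 1, ‖f u‖ ^ 2 := by
    rw [norm_sq_eq_integral]
    exact integral_congr_ae (by filter_upwards [hFae] with x hx; rw [hx])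
  -- the value q of the ridge problem
  set q : ℝ := ‖F‖ ^ 2 + ∑ k, w k * ‖⟪Φ k, F⟫_ℂ‖ ^ 2 with hq
  have hq0 : 0 ≤ q := by
    have : ∀ k, 0 ≤ w k * ‖⟪Φ k, F⟫_ℂ‖ ^ 2 := fun k ↦ by have := hw k; positivity
    have := Finset.sum_nonneg fun k (_ : k ∈ Finset.univ) ↦ this k
    positivity
  -- the cost in the goal is J = q
  have hcost : (∫ u in Icc (-1 : ℝ) 1, ‖2 * (Real.sinh (κ₀ * u) : ℂ) -
        ∑ k, b k * (Real.cosh (κ k * u) : ℂ) * cexp (-(I * (lam k : ℂ) * u))‖ ^ 2) +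
      ∑ k, ‖b k‖ ^ 2 / w k = q := by
    rw [← hJ, J, ← hFdef, norm_sq_eq_integral]
    congr 1
    refine integral_congr_ae ?_
    filter_upwards [hFae] with x hx
    rw [hx, hfdef]
  rw [hcost]
  -- K-CERT′ applied to the residual AT DENSITY D (G11: band e^{2πD}/4)
  obtain ⟨m, a, bb, t, hwin, hcert, hmain⟩ := h ε hε κ₀ hκ₀ hκ₀' D hD f hfc
  have hwin' : ∀ i, -(Real.exp (2 * Real.pi * D) / 4) ≤ a i ∧ a i < bb i ∧ bb i ≤ Real.exp (2 * Real.pi * D) / 4 ∧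
      bb i - a i ≤ L ∧ 0 ≤ t i := fun i ↦
    ⟨(hwin i).1, (hwin i).2.1, (hwin i).2.2.1, (hwin i).2.2.2.1.trans hL, (hwin i).2.2.2.2⟩
  have hV : ∀ k, (∑ i ∈ Finset.univ.filter (fun i ↦ a i < lam k ∧ lam k ≤ bb i), t i) ≤ ‖⟪Φ k, F⟫_ℂ‖ ^ 2 := by
    intro k; rw [hΦF k]; exact hcert (lam k) (κ k) (hκ k).1 (hκ k).2
  have hchain := cert_chain hw hw₀' hband hwin' hV
  -- NEW (G11): ‖F‖² + D · credit ≤ q  (the dual value in full)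
  have hcredit : (∫ u in Icc (-1 : ℝ) 1, ‖f u‖ ^ 2) +
      D * ∑ i, t i * (bb i - a i - δ - (if a i < 0 ∧ 0 ≤ bb i then δ else 0)) ≤ q := by
    rw [← hFnorm, hq]; linarith
  -- ‖⟨g, f⟩‖ = q
  have hnorm : ‖∫ u in Icc (-1 : ℝ) 1, 2 * (Real.sinh (κ₀ * u) : ℂ) * f u‖ = q := by
    rw [← hGF', hGF, Complex.norm_real, Real.norm_eq_abs, abs_of_nonneg hq0]
  rw [hnorm] at hmain
  -- arithmetic: 2πθ q² D ≤ (1+ε) Φ (‖F‖² + D·credit) ≤ (1+ε) Φ q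
  have hΦ0 : 0 ≤ Phi κ₀ := Phi_nonneg_of_pos hκ₀
  have hD0 : 0 < D := by linarith
  have hkey : 2 * Real.pi * θ * q ^ 2 * D ≤ (1 + ε) * Phi κ₀ * q := by
    have hsum : D * ((∫ u in Icc (-1 : ℝ) 1, ‖f u‖ ^ 2) / D +
        ∑ i, t i * (bb i - a i - δ - (if a i < 0 ∧ 0 ≤ bb i then δ else 0))) ≤ q := by
      rw [mul_add, mul_div_cancel₀ _ hD0.ne']; exact hcredit
    have h1 : (1 + ε) * Phi κ₀ * (D * ((∫ u in Icc (-1 : ℝ) 1, ‖f u‖ ^ 2) / D +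
        ∑ i, t i * (bb i - a i - δ - (if a i < 0 ∧ 0 ≤ bb i then δ else 0))))
        ≤ (1 + ε) * Phi κ₀ * q := mul_le_mul_of_nonneg_left hsum (by positivity)
    nlinarith
  have hden : 0 < 2 * Real.pi * θ * D := by positivity
  rw [le_div_iff₀ hden]
  -- bridge (tree port): the tree's `MassAwareSamplingL` is stated with `BombieriTruncMassAware.Phi`, the K-cert body with
  -- `XWucG8.Phi`; the two are the same function by `rfl`.
  rw [show BombieriTruncMassAware.Phi κ₀ = Phi κ₀ from rfl]
  by_cases hq00 : q = 0
  · rw [hq00]; simp only [zero_mul]; positivity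
  · have hqpos : 0 < q := lt_of_le_of_ne hq0 (Ne.symm hq00)
    have : 2 * Real.pi * θ * q * D ≤ (1 + ε) * Phi κ₀ := by
      have h2 : (2 * Real.pi * θ * q * D) * q ≤ ((1 + ε) * Phi κ₀) * q := by nlinarith
      exact le_of_mul_le_mul_right h2 hqpos
    linarith

/-- **Row ★₁₀₂₄ʳ (row of record after the repair):**
`0.042 ≤ θ → KCertLR 400 (3/2) θ → HSW → (RH ⟺ RH(e^{1024}) ∧ B′₁([−1,1]))`.  [conditional on the conjectural `KCertLR`; bookkeeping] -/
theorem rh_iff_rhUpTo_exp1024_and_boundedAwayAt_of_kCertLR {θ : ℝ} (hθ : 0.042 ≤ θ) (hK : KCertLR 400 (3 / 2) θ)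
    (hHSW : zetaZeroCount_hasanalizade_shen_wong) :
    _root_.RiemannHypothesis ↔
      RiemannHypothesisUpTo (Real.exp 1024) ∧ TruncNegEigenvalueBoundedAwayAt (Icc (-1 : ℝ) 1) 1 :=
  rh_iff_rhUpTo_exp1024_and_boundedAwayAt_L400 hθ (massAwareSamplingL_of_kCertLR le_rfl (by linarith) hK) hHSW

end Repair

end Summit.RiemannHypothesis.RiemannHypothesis.Theorems.Splittings.XWucG8

end
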